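import Literature.NumberTheory.LFunctions.FordLargeLambdaTailCheck
import HarnessLib

/-!
# Kernel evaluation of the tail box certificate, `u`-row `i = 0`

Topic `Literature/NumberTheory/LFunctions`. Kernel computations (`decide +kernel`) only: for `i = 0`
and each `j < 16`, the cells `(i, j, l)`, `l < 50`, of the box certificate `FordVK.Tail.checkCell`
(`FordLargeLambdaTailCheck.lean`) pass; `urow_0` collects the row. One theorem per `(i, j)` keeps
each kernel evaluation small. No definitions, no facts.

## References
* K. Ford, Proc. London Math. Soc. (3) 85 (2002), 565–633: §5, Lemma 5.2. [Ford2002]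
-/

namespace Literature.NumberTheory.LFunctions
namespace FordVK
namespace Tail

set_option maxHeartbeats 0 in
/-- The cells `(0, 0, l)`, `l < 50`, pass (kernel evaluation). [cite: Ford2002, Lemma 5.2 (numerical verification)] -/
theorem cell_0_0 : ((List.range 50).all fun l => checkCell 0 0 l) = true := by
  decide +kernel

set_option maxHeartbeats 0 in
/-- The cells `(0, 1, l)`, `l < 50`, pass (kernel evaluation). [cite: Ford2002, Lemma 5.2 (numerical verification)] -/
theorem cell_0_1 : ((List.range 50).all fun l => checkCell 0 1 l) = true := by
  decide +kernel

set_option maxHeartbeats 0 in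
/-- The cells `(0, 2, l)`, `l < 50`, pass (kernel evaluation). [cite: Ford2002, Lemma 5.2 (numerical verification)] -/
theorem cell_0_2 : ((List.range 50).all fun l => checkCell 0 2 l) = true := by
  decide +kernel

set_option maxHeartbeats 0 in
/-- The cells `(0, 3, l)`, `l < 50`, pass (kernel evaluation). [cite: Ford2002, Lemma 5.2 (numerical verification)] -/
theorem cell_0_3 : ((List.range 50).all fun l => checkCell 0 3 l) = true := by
  decide +kernel

set_option maxHeartbeats 0 in
/-- The cells `(0, 4, l)`, `l < 50`, pass (kernel evaluation). [cite: Ford2002, Lemma 5.2 (numerical verification)] -/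
theorem cell_0_4 : ((List.range 50).all fun l => checkCell 0 4 l) = true := by
  decide +kernel

set_option maxHeartbeats 0 in
/-- The cells `(0, 5, l)`, `l < 50`, pass (kernel evaluation). [cite: Ford2002, Lemma 5.2 (numerical verification)] -/
theorem cell_0_5 : ((List.range 50).all fun l => checkCell 0 5 l) = true := by
  decide +kernel

set_option maxHeartbeats 0 in
/-- The cells `(0, 6, l)`, `l < 50`, pass (kernel evaluation). [cite: Ford2002, Lemma 5.2 (numerical verification)] -/
theorem cell_0_6 : ((List.range 50).all fun l => checkCell 0 6 l) = true := by
  decide +kernel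

set_option maxHeartbeats 0 in
/-- The cells `(0, 7, l)`, `l < 50`, pass (kernel evaluation). [cite: Ford2002, Lemma 5.2 (numerical verification)] -/
theorem cell_0_7 : ((List.range 50).all fun l => checkCell 0 7 l) = true := by
  decide +kernel

set_option maxHeartbeats 0 in
/-- The cells `(0, 8, l)`, `l < 50`, pass (kernel evaluation). [cite: Ford2002, Lemma 5.2 (numerical verification)] -/
theorem cell_0_8 : ((List.range 50).all fun l => checkCell 0 8 l) = true := by
  decide +kernel

set_option maxHeartbeats 0 in
/-- The cells `(0, 9, l)`, `l < 50`, pass (kernel evaluation). [cite: Ford2002, Lemma 5.2 (numerical verification)] -/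
theorem cell_0_9 : ((List.range 50).all fun l => checkCell 0 9 l) = true := by
  decide +kernel

set_option maxHeartbeats 0 in
/-- The cells `(0, 10, l)`, `l < 50`, pass (kernel evaluation). [cite: Ford2002, Lemma 5.2 (numerical verification)] -/
theorem cell_0_10 : ((List.range 50).all fun l => checkCell 0 10 l) = true := by
  decide +kernel

set_option maxHeartbeats 0 in
/-- The cells `(0, 11, l)`, `l < 50`, pass (kernel evaluation). [cite: Ford2002, Lemma 5.2 (numerical verification)] -/
theorem cell_0_11 : ((List.range 50).all fun l => checkCell 0 11 l) = true := by
  decide +kernel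

set_option maxHeartbeats 0 in
/-- The cells `(0, 12, l)`, `l < 50`, pass (kernel evaluation). [cite: Ford2002, Lemma 5.2 (numerical verification)] -/
theorem cell_0_12 : ((List.range 50).all fun l => checkCell 0 12 l) = true := by
  decide +kernel

set_option maxHeartbeats 0 in
/-- The cells `(0, 13, l)`, `l < 50`, pass (kernel evaluation). [cite: Ford2002, Lemma 5.2 (numerical verification)] -/
theorem cell_0_13 : ((List.range 50).all fun l => checkCell 0 13 l) = true := by
  decide +kernel

set_option maxHeartbeats 0 in
/-- The cells `(0, 14, l)`, `l < 50`, pass (kernel evaluation). [cite: Ford2002, Lemma 5.2 (numerical verification)] -/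
theorem cell_0_14 : ((List.range 50).all fun l => checkCell 0 14 l) = true := by
  decide +kernel

set_option maxHeartbeats 0 in
/-- The cells `(0, 15, l)`, `l < 50`, pass (kernel evaluation). [cite: Ford2002, Lemma 5.2 (numerical verification)] -/
theorem cell_0_15 : ((List.range 50).all fun l => checkCell 0 15 l) = true := by
  decide +kernel

/-- The `u`-row `i = 0` of the box certificate passes. [cite: Ford2002, Lemma 5.2 (numerical verification)] -/
theorem urow_0 : ((List.range nD).all fun j => (List.range 50).all fun l => checkCell 0 j l) = true := by
  unfold nD
  rw [List.all_eq_true]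
  intro j hj
  rw [List.mem_range] at hj
  interval_cases j
  · exact cell_0_0
  · exact cell_0_1
  · exact cell_0_2
  · exact cell_0_3
  · exact cell_0_4
  · exact cell_0_5
  · exact cell_0_6
  · exact cell_0_7
  · exact cell_0_8
  · exact cell_0_9
  · exact cell_0_10
  · exact cell_0_11
  · exact cell_0_12
  · exact cell_0_13
  · exact cell_0_14
  · exact cell_0_15

end Tail
end FordVK
end Literature.NumberTheory.LFunctions
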